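import Literature.AlgebraicGeometry.ShimuraVarieties.HeckeCorrespondenceAction
import Literature.AlgebraicGeometry.HodgeTheory.RationalHodgeClasses
import Literature.Geometry.Kaehler.AnalyticSetRegularUnion
import Literature.Geometry.Kaehler.AnalyticSetSingularLocus
import Literature.Geometry.Kaehler.AnalyticSetProjection
import Mathlib.Topology.Algebra.ConstMulAction
import Mathlib.Geometry.Manifold.IsManifold.Basic
import Mathlib.Geometry.Manifold.MFDeriv.SpecificFunctions
import Mathlib.Analysis.Normed.Module.FiniteDimension

/-!
# The Hecke image in the square of a Hodge model of `X` is analytic of codimension `dim X`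
# (S2b assembly, part 1; crux `EndoscopicMiddleDegree.OrthogonalEnveloped`, stmt-HodgeConjecture-14300, lead seat c3)

For a compact ball quotient datum `D` on `X`, an admissible `g` and a Hodge model `A` of `X`, the image of
the topological Hecke graph `ℓ ↦ (π ℓ, π_g ℓ)` of `N_g \ 𝔹`, read in `A.carrier × A.carrier`
is a closed analytic subset all of whose regular points have codimension `dim X`
(`heckeImageModel_analytic`) — GRANTED, as explicit hypotheses spelled out verbatim, the registered analytic
sub-stubs of the construction stub `stub_heckeGraphAnalytic` (S2b) of the line `purity-sorted-hecke-envelope`: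
B `stub_unifHolomorphic` (landed p110764), A1 `stub_unifSliceSection`, A2 `stub_sectionHolomorphicOfInjOn`,
C `stub_graphOnRegular` (landed p110690), D `stub_regularPointOfFiniteUnion` (hypotheses rather than imports
only because the farm does not yet serve the freshly landed modules; the composition with the landed stubs is a
one-liner filed separately). Proof: over the domain `W ∋ a` of a local holomorphic section `σ` of `unif`
(A1 + A2 + B) the image is the finite union over `q ∈ Γ / N_g` of the graphs of the holomorphic branches
`f_q = φ⁻¹ ∘ unif ∘ (g γ_q) ∘ σ ∘ φ` (`exists_local_branches`: the fibre of `π` is a deck orbit,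
`exists_smul_of_levelProj_eq`, and `π_g` on a translated sheet is `unif ∘ (g γ)`, `coverMap_comp_smul`);
graphs are analytic at points over `W` (C) and finite unions stay analytic; at a regular point `x` of
codimension `q`, over a compact neighbourhood `K ⊆ W` of `x.1` the pieces are closed, D selects one graph of
which `x` is regular of codimension `q`, and C with `IsRegularPointOfCodim.codim_unique` gives `q = dim X`.

References: Shimura 1971 Ch. 7 §7.2 (Hecke correspondences as graphs over level covers); BMM arXiv:1306.1515
Part 2 §1.8; Chirka, *Complex Analytic Sets* §2.3, §5.3.
-/

noncomputable section

-- The crux-workfile namespace `Summit.<P>.<Sub>.Cruxes.…` repeats `HodgeConjecture` (single-conjunct summit).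
set_option linter.dupNamespace false

namespace Summit.HodgeConjecture.HodgeConjecture.Cruxes.OrthogonalEnveloped.HeckeGraphChow

open scoped Manifold ContDiff Topology
open Set Filter MulAction
open Literature.AlgebraicGeometry.Motives (SchemeOver ComplexPoints)
open Literature.AlgebraicGeometry.HodgeTheory (HodgeModel)
open Literature.AlgebraicGeometry.ShimuraVarieties
open Literature.Geometry.Kaehler


/-! ## The two projections of the Hecke correspondence on the points `q • N[v]` -/

section Hecke

open MulAction

variable {p : ℕ} {X : SchemeOver ℂ} (D : UnitaryBallQuotientDatum p X)

/-- `π (q • N[v]) = unif v`: the level projection is invariant under the deck group and is `unif` on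
translated projection of `g γ` (`coverMap_comp_smul`). [cite: Shimura1973, §3.1 and Ch. 7 §7.3] -/
theorem twist_mk_smul_toLevel_toBall {g : GL (Fin (p + 1)) D.E} (h : D.IsHeckeAdmissible g)
    (γ : ↥D.Γ) (v : D.cone) :
    UnitaryBallQuotientDatum.IsHeckeAdmissible.twist D h
        ((QuotientGroup.mk γ : ↥D.Γ ⧸ D.heckeLevel g) • D.toLevel (D.heckeLevel g) (D.toBall v)) =
      D.unif (D.act (g * (γ : GL (Fin (p + 1)) D.E)) v) := by
  have key := congrArg (fun F ↦ F (D.toLevel (D.heckeLevel g) (D.toBall v)))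
    (D.coverMap_comp_smul (D.heckeLevel g) g h.mem_unitaryGroup
      (fun _ hγ ↦ D.conj_mem_of_mem_heckeLevel g hγ) γ)
  simp only [ContinuousMap.comp_apply, ContinuousMap.coe_mk] at key
  exact key

end Hecke

/-! ## Local structure of the Hecke image in the square of a Hodge model of `X` -/

section Local

open MulAction

variable {p : ℕ} {X : SchemeOver ℂ} (D : UnitaryBallQuotientDatum p X) (A : HodgeModel p X)

/-- **The Hecke image over the domain of a section is the union of the graphs of the branches.** For an
admissible `g`, a local section `σ` of `unif` on `U` (values in the cone) and `z = (a, b)` with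
`φ a ∈ U`: `(φ a, φ b)` lies on the topological Hecke graph `{(π ℓ, π_g ℓ)}` iff `b = f_γ a` for some
coset `γ N_g` (`γ = q.out`): the fibre of `π` over `φ a` is the deck-orbit of the point `N_g[σ (φ a)]`
(`exists_smul_of_levelProj_eq`), on which `π_g` is `unif ∘ (g γ)` (`coverMap_comp_smul`).
[cite: Shimura1973, §3.1 and Ch. 7 §7.2] -/
theorem mem_heckeImage_iff {g : GL (Fin (p + 1)) D.E} (h : D.IsHeckeAdmissible g)
    {U : Set (ComplexPoints X)} {σ : ComplexPoints X → (Fin (p + 1) → ℂ)}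
    (hσ : ∀ Q ∈ U, σ Q ∈ D.cone ∧ D.unif (σ Q) = Q) {z : A.carrier × A.carrier}
    (hz : A.toComplexPoints z.1 ∈ U) :
    (∃ ℓ : D.LevelCover (D.heckeLevel g), D.levelProj (D.heckeLevel g) ℓ = A.toComplexPoints z.1 ∧
        UnitaryBallQuotientDatum.IsHeckeAdmissible.twist D h ℓ = A.toComplexPoints z.2) ↔
      ∃ q : ↥D.Γ ⧸ D.heckeLevel g, z.2 = A.isAnalytification.isHomeomorph.homeomorph.symm
          (D.unif (D.act (g * ((q.out : ↥D.Γ) : GL (Fin (p + 1)) D.E)) (σ (A.toComplexPoints z.1)))) := by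
  set Q := A.toComplexPoints z.1 with hQ
  obtain ⟨hQc, hQu⟩ := hσ Q hz
  set v : D.cone := ⟨σ Q, hQc⟩ with hv
  set ℓ₁ : D.LevelCover (D.heckeLevel g) := D.toLevel (D.heckeLevel g) (D.toBall v) with hℓ₁
  have hπ₁ : D.levelProj (D.heckeLevel g) ℓ₁ = Q := hQu
  constructor
  · rintro ⟨ℓ, hℓ, hℓ'⟩
    obtain ⟨q, rfl⟩ := D.exists_smul_of_levelProj_eq (D.heckeLevel g) (e := ℓ₁) (e' := ℓ) (hℓ.trans hπ₁.symm)
    refine ⟨q, ?_⟩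
    apply A.isAnalytification.isHomeomorph.injective
    change A.toComplexPoints z.2 = (A.isAnalytification.isHomeomorph.homeomorph)
      ((A.isAnalytification.isHomeomorph.homeomorph).symm _)
    rw [Homeomorph.apply_symm_apply, ← hℓ']
    conv_lhs => rw [← QuotientGroup.out_eq' q]
    exact twist_mk_smul_toLevel_toBall D h q.out v
  · rintro ⟨q, hq⟩
    refine ⟨q • ℓ₁, ?_, ?_⟩
    · rw [D.levelProj_smul, hπ₁]
    · rw [hq]
      change _ = (A.isAnalytification.isHomeomorph.homeomorph)
        ((A.isAnalytification.isHomeomorph.homeomorph).symm _)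
      rw [Homeomorph.apply_symm_apply]
      conv_lhs => rw [← QuotientGroup.out_eq' q]
      exact twist_mk_smul_toLevel_toBall D h q.out v

end Local

/-! ## Local branches: holomorphy and the graph description, from Stubs B, A1, A2 -/

section Branches

open MulAction

variable {p : ℕ} {X : SchemeOver ℂ}

/-- The action `v ↦ (M^{τ₁}) v` of `GL_{p+1}(E)` on `ℂ^{p+1}` is a continuous linear map, hence
holomorphic. [folklore] -/
theorem mdifferentiable_act (D : UnitaryBallQuotientDatum p X) (M : GL (Fin (p + 1)) D.E) :
    MDifferentiable 𝓘(ℂ, Fin (p + 1) → ℂ) 𝓘(ℂ, Fin (p + 1) → ℂ) (D.act M) := by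
  have hL : D.act M = (LinearMap.toContinuousLinearMap
      (Matrix.mulVecLin ((M : Matrix (Fin (p + 1)) (Fin (p + 1)) D.E).map D.τ₁))) := by
    funext v
    rfl
  rw [hL]
  exact ContinuousLinearMap.mdifferentiable _

variable
  (hB : ∀ {p : ℕ} {X : SchemeOver ℂ} (D : UnitaryBallQuotientDatum p X) (A : HodgeModel p X),
      MDifferentiableOn 𝓘(ℂ, Fin (p + 1) → ℂ) 𝓘(ℂ, A.model)
        (fun v ↦ A.isAnalytification.isHomeomorph.homeomorph.symm (D.unif v)) D.cone)
  (hA1 : ∀ {p : ℕ} {X : SchemeOver ℂ} (D : UnitaryBallQuotientDatum p X)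
      [ProperlyDiscontinuousSMul ↥D.Γ D.ball] [IsCancelSMul ↥D.Γ D.ball]
      [LocallyCompactSpace D.ball] [T2Space D.ball] (P : ComplexPoints X),
      ∃ (U : Set (ComplexPoints X)) (σ : ComplexPoints X → (Fin (p + 1) → ℂ)) (i : Fin (p + 1))
        (V : Set (Fin (p + 1) → ℂ)),
        IsOpen U ∧ P ∈ U ∧ ContinuousOn σ U ∧ IsOpen V ∧ V ⊆ D.cone ∧
          (∀ Q ∈ U, σ Q ∈ V ∧ σ Q i = 1 ∧ D.unif (σ Q) = Q) ∧
          Set.InjOn D.unif {v ∈ V | v i = 1})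
  (hA2 : ∀ {p : ℕ} {X : SchemeOver ℂ} (D : UnitaryBallQuotientDatum p X) (A : HodgeModel p X),
      MDifferentiableOn 𝓘(ℂ, Fin (p + 1) → ℂ) 𝓘(ℂ, A.model)
        (fun v ↦ A.isAnalytification.isHomeomorph.homeomorph.symm (D.unif v)) D.cone →
      ∀ (U : Set (ComplexPoints X)) (σ : ComplexPoints X → (Fin (p + 1) → ℂ)) (i : Fin (p + 1))
        (V : Set (Fin (p + 1) → ℂ)),
        IsOpen U → ContinuousOn σ U → IsOpen V → V ⊆ D.cone →
        (∀ Q ∈ U, σ Q ∈ V ∧ σ Q i = 1 ∧ D.unif (σ Q) = Q) →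
        Set.InjOn D.unif {v ∈ V | v i = 1} →
        MDifferentiableOn 𝓘(ℂ, A.model) 𝓘(ℂ, Fin (p + 1) → ℂ) (σ ∘ A.toComplexPoints)
          (A.toComplexPoints ⁻¹' U))
  (hC : ∀ {E : Type} [NormedAddCommGroup E] [NormedSpace ℂ E] [FiniteDimensional ℂ E]
      {F : Type} [NormedAddCommGroup F] [NormedSpace ℂ F] [FiniteDimensional ℂ F]
      {M : Type} [TopologicalSpace M] [ChartedSpace E M]
      {N : Type} [TopologicalSpace N] [T2Space N] [ChartedSpace F N] [IsManifold 𝓘(ℂ, F) ω N]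
      (W : Set M) (f : M → N), IsOpen W → MDifferentiableOn 𝓘(ℂ, E) 𝓘(ℂ, F) f W →
      (∀ z : M × N, z.1 ∈ W →
          IsAnalyticSetAt (𝓘(ℂ, E).prod 𝓘(ℂ, F)) {z : M × N | z.1 ∈ W ∧ z.2 = f z.1} z) ∧
        ∀ z : M × N, z.1 ∈ W → z.2 = f z.1 →
          IsRegularPointOfCodim (𝓘(ℂ, E).prod 𝓘(ℂ, F)) {z : M × N | z.1 ∈ W ∧ z.2 = f z.1}
            (Module.finrank ℂ F) z)
  (hD : ∀ {E : Type} [NormedAddCommGroup E] [NormedSpace ℂ E] [FiniteDimensional ℂ E]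
      {H : Type} [TopologicalSpace H] {I : ModelWithCorners ℂ E H} [I.Boundaryless]
      {M : Type} [TopologicalSpace M] [ChartedSpace H M] [IsManifold I 1 M]
      {ι : Type} (s : Finset ι) (S : ι → Set M) (x : M) (q : ℕ),
      (∀ i ∈ s, IsAnalyticSetAt I (S i) x) → (∀ i ∈ s, IsClosed (S i)) →
      x ∈ regularLocus I (⋃ i ∈ s, S i) → IsRegularPointOfCodim I (⋃ i ∈ s, S i) q x →
      ∃ i ∈ s, x ∈ S i ∧ IsRegularPointOfCodim I (S i) q x)

include hB hA1 hA2 in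
/-- **Local branches of the Hecke correspondence (from Stubs B, A1, A2).** Around every point `a₀` of a
Hodge model `A` of `X` there are an open `W ∋ a₀` and a section `σ` of `unif` over `φ(W)` such that every
branch `f_γ = φ⁻¹ ∘ unif ∘ (g γ) ∘ σ ∘ φ` is holomorphic on `W`, and over `W` the topological Hecke graph of
an admissible `g` is the union of the graphs of the `f_{q.out}`, `q ∈ Γ / N_g`.
[cite: Shimura1973, Ch. 7 §7.2] [cite: BergeronMillsonMoeglin2016Balls, Part 2 §1.8] -/
theorem exists_local_branches (D : UnitaryBallQuotientDatum p X) [ProperlyDiscontinuousSMul ↥D.Γ D.ball] [IsCancelSMul ↥D.Γ D.ball]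
    [LocallyCompactSpace D.ball] [T2Space D.ball] (A : HodgeModel p X) {g : GL (Fin (p + 1)) D.E}
    (h : D.IsHeckeAdmissible g) (a₀ : A.carrier) :
    ∃ (W : Set A.carrier) (σ : ComplexPoints X → (Fin (p + 1) → ℂ)), IsOpen W ∧ a₀ ∈ W ∧
      (∀ γ : ↥D.Γ, MDifferentiableOn 𝓘(ℂ, A.model) 𝓘(ℂ, A.model)
        (fun a ↦ A.isAnalytification.isHomeomorph.homeomorph.symm
          (D.unif (D.act (g * (γ : GL (Fin (p + 1)) D.E)) (σ (A.toComplexPoints a))))) W) ∧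
      ∀ z : A.carrier × A.carrier, z.1 ∈ W →
        ((∃ ℓ : D.LevelCover (D.heckeLevel g), D.levelProj (D.heckeLevel g) ℓ = A.toComplexPoints z.1 ∧
            UnitaryBallQuotientDatum.IsHeckeAdmissible.twist D h ℓ = A.toComplexPoints z.2) ↔
          ∃ q : ↥D.Γ ⧸ D.heckeLevel g, z.2 = A.isAnalytification.isHomeomorph.homeomorph.symm
          (D.unif (D.act (g * ((q.out : ↥D.Γ) : GL (Fin (p + 1)) D.E)) (σ (A.toComplexPoints z.1))))) := by
  obtain ⟨U, σ, i, V, hU, hP, hσc, hV, hVc, hσ, hinj⟩ := hA1 D (A.toComplexPoints a₀)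
  have hφc : Continuous A.toComplexPoints := A.isAnalytification.isHomeomorph.continuous
  have hσφ := hA2 D A (hB D A) U σ i V hU hσc hV hVc hσ hinj
  refine ⟨A.toComplexPoints ⁻¹' U, σ, hU.preimage hφc, hP, fun γ ↦ ?_, fun z hz ↦ ?_⟩
  · -- holomorphy of the branch `f_γ = (φ⁻¹ ∘ unif) ∘ (g γ) ∘ (σ ∘ φ)`
    have hgγ : g * (γ : GL (Fin (p + 1)) D.E) ∈ unitaryGroup (conjRingHom D.E) D.H :=
      mul_mem h.mem_unitaryGroup (D.isCongruenceSubgroup.1 γ.2)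
    have h1 : MDifferentiableOn 𝓘(ℂ, Fin (p + 1) → ℂ) 𝓘(ℂ, A.model)
        (fun v ↦ A.isAnalytification.isHomeomorph.homeomorph.symm
          (D.unif (D.act (g * (γ : GL (Fin (p + 1)) D.E)) v))) D.cone :=
      (hB D A).comp (mdifferentiable_act D _).mdifferentiableOn
        (fun v hv ↦ D.act_mem_cone_of_mem_unitaryGroup hgγ hv)
    exact h1.comp hσφ (fun a ha ↦ hVc (hσ _ ha).1)
  · exact mem_heckeImage_iff D A h (fun Q hQ ↦ ⟨hVc (hσ Q hQ).1, (hσ Q hQ).2.2⟩) hz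

/-! ## The Hecke image in the square of a Hodge model of `X`: analytic of codimension `dim X` -/


/-- **The Hecke image in `A.carrier × A.carrier` is a closed analytic subset all of whose regular points
have codimension `dim X`** (from Stubs B, A1, A2, C, D and the instance hypotheses of G1): over the open
`W ∋ a` of `exists_local_branches` it is the finite union of the graphs of the holomorphic branches
(analytic at each point: Stub C + finite unions); at a regular point `x` of codimension `q`, shrinking to a
compact neighbourhood `K ⊆ W` of `x.1` makes the pieces closed, Stub D picks one graph of which `x` is a
regular point of codimension `q`, and Stub C with the uniqueness of the codimension at a regular point gives
`q = dim X`. [cite: BergeronMillsonMoeglin2016Balls, Part 2 §1.8] [cite: Chirka1989, §2.3] -/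
theorem stub_heckeImageModelAnalytic :
    (∀ {p : ℕ} {X : SchemeOver ℂ} (D : UnitaryBallQuotientDatum p X) (A : HodgeModel p X),
      MDifferentiableOn 𝓘(ℂ, Fin (p + 1) → ℂ) 𝓘(ℂ, A.model)
        (fun v ↦ A.isAnalytification.isHomeomorph.homeomorph.symm (D.unif v)) D.cone) →
    (∀ {p : ℕ} {X : SchemeOver ℂ} (D : UnitaryBallQuotientDatum p X)
      [ProperlyDiscontinuousSMul ↥D.Γ D.ball] [IsCancelSMul ↥D.Γ D.ball]
      [LocallyCompactSpace D.ball] [T2Space D.ball] (P : ComplexPoints X),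
      ∃ (U : Set (ComplexPoints X)) (σ : ComplexPoints X → (Fin (p + 1) → ℂ)) (i : Fin (p + 1))
        (V : Set (Fin (p + 1) → ℂ)),
        IsOpen U ∧ P ∈ U ∧ ContinuousOn σ U ∧ IsOpen V ∧ V ⊆ D.cone ∧
          (∀ Q ∈ U, σ Q ∈ V ∧ σ Q i = 1 ∧ D.unif (σ Q) = Q) ∧
          Set.InjOn D.unif {v ∈ V | v i = 1}) →
    (∀ {p : ℕ} {X : SchemeOver ℂ} (D : UnitaryBallQuotientDatum p X) (A : HodgeModel p X),
      MDifferentiableOn 𝓘(ℂ, Fin (p + 1) → ℂ) 𝓘(ℂ, A.model)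
        (fun v ↦ A.isAnalytification.isHomeomorph.homeomorph.symm (D.unif v)) D.cone →
      ∀ (U : Set (ComplexPoints X)) (σ : ComplexPoints X → (Fin (p + 1) → ℂ)) (i : Fin (p + 1))
        (V : Set (Fin (p + 1) → ℂ)),
        IsOpen U → ContinuousOn σ U → IsOpen V → V ⊆ D.cone →
        (∀ Q ∈ U, σ Q ∈ V ∧ σ Q i = 1 ∧ D.unif (σ Q) = Q) →
        Set.InjOn D.unif {v ∈ V | v i = 1} →
        MDifferentiableOn 𝓘(ℂ, A.model) 𝓘(ℂ, Fin (p + 1) → ℂ) (σ ∘ A.toComplexPoints)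
          (A.toComplexPoints ⁻¹' U)) →
    (∀ {E : Type} [NormedAddCommGroup E] [NormedSpace ℂ E] [FiniteDimensional ℂ E]
      {F : Type} [NormedAddCommGroup F] [NormedSpace ℂ F] [FiniteDimensional ℂ F]
      {M : Type} [TopologicalSpace M] [ChartedSpace E M]
      {N : Type} [TopologicalSpace N] [T2Space N] [ChartedSpace F N] [IsManifold 𝓘(ℂ, F) ω N]
      (W : Set M) (f : M → N), IsOpen W → MDifferentiableOn 𝓘(ℂ, E) 𝓘(ℂ, F) f W →
      (∀ z : M × N, z.1 ∈ W →
          IsAnalyticSetAt (𝓘(ℂ, E).prod 𝓘(ℂ, F)) {z : M × N | z.1 ∈ W ∧ z.2 = f z.1} z) ∧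
        ∀ z : M × N, z.1 ∈ W → z.2 = f z.1 →
          IsRegularPointOfCodim (𝓘(ℂ, E).prod 𝓘(ℂ, F)) {z : M × N | z.1 ∈ W ∧ z.2 = f z.1}
            (Module.finrank ℂ F) z) →
    (∀ {E : Type} [NormedAddCommGroup E] [NormedSpace ℂ E] [FiniteDimensional ℂ E]
      {H : Type} [TopologicalSpace H] {I : ModelWithCorners ℂ E H} [I.Boundaryless]
      {M : Type} [TopologicalSpace M] [ChartedSpace H M] [IsManifold I 1 M]
      {ι : Type} (s : Finset ι) (S : ι → Set M) (x : M) (q : ℕ),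
      (∀ i ∈ s, IsAnalyticSetAt I (S i) x) → (∀ i ∈ s, IsClosed (S i)) →
      x ∈ regularLocus I (⋃ i ∈ s, S i) → IsRegularPointOfCodim I (⋃ i ∈ s, S i) q x →
      ∃ i ∈ s, x ∈ S i ∧ IsRegularPointOfCodim I (S i) q x) →
    ∀ {p : ℕ} {X : SchemeOver ℂ} (D : UnitaryBallQuotientDatum p X)
      [ProperlyDiscontinuousSMul ↥D.Γ D.ball] [IsCancelSMul ↥D.Γ D.ball]
      [LocallyCompactSpace D.ball] [T2Space D.ball] (A : HodgeModel p X) {g : GL (Fin (p + 1)) D.E}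
      (h : D.IsHeckeAdmissible g),
      IsAnalyticSet (𝓘(ℂ, A.model).prod 𝓘(ℂ, A.model))
        {z : A.carrier × A.carrier | ∃ ℓ : D.LevelCover (D.heckeLevel g),
          D.levelProj (D.heckeLevel g) ℓ = A.toComplexPoints z.1 ∧
            UnitaryBallQuotientDatum.IsHeckeAdmissible.twist D h ℓ = A.toComplexPoints z.2} ∧
      ∀ x ∈ regularLocus (𝓘(ℂ, A.model).prod 𝓘(ℂ, A.model))
        {z : A.carrier × A.carrier | ∃ ℓ : D.LevelCover (D.heckeLevel g),
          D.levelProj (D.heckeLevel g) ℓ = A.toComplexPoints z.1 ∧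
            UnitaryBallQuotientDatum.IsHeckeAdmissible.twist D h ℓ = A.toComplexPoints z.2}, ∀ q : ℕ,
        IsRegularPointOfCodim (𝓘(ℂ, A.model).prod 𝓘(ℂ, A.model))
          {z : A.carrier × A.carrier | ∃ ℓ : D.LevelCover (D.heckeLevel g),
          D.levelProj (D.heckeLevel g) ℓ = A.toComplexPoints z.1 ∧
            UnitaryBallQuotientDatum.IsHeckeAdmissible.twist D h ℓ = A.toComplexPoints z.2} q x →
          Module.finrank ℂ A.model ≤ q := by
  intro hB hA1 hA2 hC hD p X D _ _ _ _ A g h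
  classical
  haveI : (D.heckeLevel g).FiniteIndex := h.finiteIndex
  letI : Fintype (↥D.Γ ⧸ D.heckeLevel g) := Subgroup.fintypeQuotientOfFiniteIndex
  set S := {z : A.carrier × A.carrier | ∃ ℓ : D.LevelCover (D.heckeLevel g),
    D.levelProj (D.heckeLevel g) ℓ = A.toComplexPoints z.1 ∧
      UnitaryBallQuotientDatum.IsHeckeAdmissible.twist D h ℓ = A.toComplexPoints z.2} with hSdef
  -- the branches `f σ γ = φ⁻¹ ∘ unif ∘ (g γ) ∘ σ ∘ φ`
  let f : (ComplexPoints X → (Fin (p + 1) → ℂ)) → ↥D.Γ → A.carrier → A.carrier :=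
    fun σ γ a ↦ A.isAnalytification.isHomeomorph.homeomorph.symm
      (D.unif (D.act (g * (γ : GL (Fin (p + 1)) D.E)) (σ (A.toComplexPoints a))))
  -- the graph of a branch over `W`
  let Graph : Set A.carrier → (ComplexPoints X → (Fin (p + 1) → ℂ)) → (↥D.Γ ⧸ D.heckeLevel g) →
      Set (A.carrier × A.carrier) :=
    fun W σ q ↦ {z | z.1 ∈ W ∧ z.2 = f σ q.out z.1}
  -- over `W`, the Hecke image is the union of the graphs
  have hunion : ∀ (W : Set A.carrier) (σ : ComplexPoints X → (Fin (p + 1) → ℂ)),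
      (∀ z : A.carrier × A.carrier, z.1 ∈ W →
        ((∃ ℓ : D.LevelCover (D.heckeLevel g), D.levelProj (D.heckeLevel g) ℓ = A.toComplexPoints z.1 ∧
            UnitaryBallQuotientDatum.IsHeckeAdmissible.twist D h ℓ = A.toComplexPoints z.2) ↔
          ∃ q : ↥D.Γ ⧸ D.heckeLevel g, z.2 = f σ q.out z.1)) →
      ∀ O : Set (A.carrier × A.carrier), O ⊆ W ×ˢ univ →
        S ∩ O = (⋃ q ∈ (Finset.univ : Finset (↥D.Γ ⧸ D.heckeLevel g)), Graph W σ q) ∩ O := by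
    intro W σ hiff O hO
    ext z
    simp only [mem_inter_iff, mem_iUnion, Finset.mem_univ, exists_true_left]
    constructor
    · rintro ⟨hz, hzO⟩
      have hz1 : z.1 ∈ W := (hO hzO).1
      obtain ⟨q, hq⟩ := (hiff z hz1).1 hz
      exact ⟨⟨q, hz1, hq⟩, hzO⟩
    · rintro ⟨⟨q, hz1, hq⟩, hzO⟩
      exact ⟨(hiff z hz1).2 ⟨q, hq⟩, hzO⟩
  constructor
  · -- analyticity at every point
    intro z₀
    obtain ⟨W, σ, hW, ha₀, hf, hiff⟩ := exists_local_branches hB hA1 hA2 D A h z₀.1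
    have hO : IsOpen (W ×ˢ (univ : Set A.carrier)) := hW.prod isOpen_univ
    have hz₀O : z₀ ∈ W ×ˢ (univ : Set A.carrier) := ⟨ha₀, mem_univ _⟩
    have hT : ∀ s : Finset (↥D.Γ ⧸ D.heckeLevel g),
        IsAnalyticSetAt (𝓘(ℂ, A.model).prod 𝓘(ℂ, A.model)) (⋃ q ∈ s, Graph W σ q) z₀ := by
      intro s
      induction s using Finset.induction_on with
      | empty =>
        have h0 : (⋃ q ∈ (∅ : Finset (↥D.Γ ⧸ D.heckeLevel g)), Graph W σ q) = ∅ := by simp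
        rw [h0]
        exact isAnalyticSet_empty z₀
      | insert a s _ ih =>
        rw [Finset.set_biUnion_insert]
        exact ((hC W (f σ a.out) hW (hf a.out)).1 z₀ ha₀).union ih
    exact IsAnalyticSetAt.congr_set hO hz₀O (hunion W σ hiff _ Subset.rfl).symm (hT _)
  · -- regular points have codimension `dim X`
    intro x hx q' hq'
    obtain ⟨W, σ, hW, ha₀, hf, hiff⟩ := exists_local_branches hB hA1 hA2 D A h x.1
    haveI : LocallyCompactSpace A.carrier := ChartedSpace.locallyCompactSpace A.model A.carrier
    obtain ⟨K, hK, hxK, hKW⟩ := exists_compact_subset hW ha₀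
    -- closed pieces: the graphs over the compact `K`
    let G : (↥D.Γ ⧸ D.heckeLevel g) → Set (A.carrier × A.carrier) :=
      fun q ↦ (fun a ↦ (a, f σ q.out a)) '' K
    have hGc : ∀ q, IsClosed (G q) := fun q ↦
      (hK.image_of_continuousOn
        (continuousOn_id.prodMk ((hf q.out).continuousOn.mono hKW))).isClosed
    have hO' : IsOpen (interior K ×ˢ (univ : Set A.carrier)) := isOpen_interior.prod isOpen_univ
    have hxO' : x ∈ interior K ×ˢ (univ : Set A.carrier) := ⟨hxK, mem_univ _⟩
    have hGO : ∀ q, G q ∩ interior K ×ˢ (univ : Set A.carrier) =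
        Graph W σ q ∩ interior K ×ˢ (univ : Set A.carrier) := by
      intro q
      ext z
      simp only [mem_inter_iff, mem_prod, mem_univ, and_true]
      constructor
      · rintro ⟨⟨a, haK, rfl⟩, hzi⟩
        exact ⟨⟨hKW haK, rfl⟩, hzi⟩
      · rintro ⟨⟨hzW, hz2⟩, hzi⟩
        exact ⟨⟨z.1, interior_subset hzi, Prod.ext rfl hz2.symm⟩, hzi⟩
    have hGan : ∀ q, IsAnalyticSetAt (𝓘(ℂ, A.model).prod 𝓘(ℂ, A.model)) (G q) x := fun q ↦
      IsAnalyticSetAt.congr_set hO' hxO' (hGO q).symm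
        ((hC W (f σ q.out) hW (hf q.out)).1 x ha₀)
    -- near `x`, the Hecke image is the union of the closed pieces
    have hSO : S ∩ interior K ×ˢ (univ : Set A.carrier) =
        (⋃ q ∈ (Finset.univ : Finset (↥D.Γ ⧸ D.heckeLevel g)), G q) ∩
          interior K ×ˢ (univ : Set A.carrier) := by
      rw [hunion W σ hiff _ (prod_mono (interior_subset.trans hKW) Subset.rfl), iUnion₂_inter,
        iUnion₂_inter]
      exact iUnion₂_congr fun q _ ↦ (hGO q).symm
    have hq'T := IsRegularPointOfCodim.congr_set hO' hxO' hSO hq'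
    have hxT : x ∈ regularLocus (𝓘(ℂ, A.model).prod 𝓘(ℂ, A.model))
        (⋃ q ∈ (Finset.univ : Finset (↥D.Γ ⧸ D.heckeLevel g)), G q) :=
      ⟨(hSO.subset ⟨hx.1, hxO'⟩).1, q', hq'T⟩
    obtain ⟨q₀, -, hxG, hreg⟩ := hD Finset.univ G x q' (fun q _ ↦ hGan q) (fun q _ ↦ hGc q) hxT hq'T
    -- back to the graph over `W`, where Stub C computes the codimension
    have hreg' : IsRegularPointOfCodim (𝓘(ℂ, A.model).prod 𝓘(ℂ, A.model)) (Graph W σ q₀) q' x :=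
      IsRegularPointOfCodim.congr_set hO' hxO' (hGO q₀) hreg
    have hxGraph : x ∈ Graph W σ q₀ := by
      obtain ⟨a, haK, hax⟩ := hxG
      rw [← hax]
      exact ⟨hKW haK, rfl⟩
    have hregC := (hC W (f σ q₀.out) hW (hf q₀.out)).2 x hxGraph.1 hxGraph.2
    exact (hregC.codim_unique hxGraph hreg').le

end Branches

end Summit.HodgeConjecture.HodgeConjecture.Cruxes.OrthogonalEnveloped.HeckeGraphChow

end
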